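import Summits.Ventures.LatticeQCDFlow.Scaling.ReplicaExchangeBareSampler

/-!
HONEST FRAMING: exact (Metropolis-corrected) sampling algorithms for lattice gauge theory; figures
of merit are autocorrelation/cost numbers at stated couplings and volumes; no continuum-physics
claim.

# ReplicaExchangeGraphSwap — REPLICA EXCHANGE ON AN ARBITRARY SWAP GRAPH WITH (OPTIONAL) TRANSPORT MAPS: A LIST OF
# LEVEL PAIRS `e_r = (i_r, l_r)` AND BIJECTIONS `φ_r`, ONE PAIR CHOSEN UNIFORMLY, THE CONFIGURATIONS EXCHANGED THROUGH
# `φ_r` AND METROPOLIS-CORRECTED — EXACT FOR EVERY GRAPH AND EVERY FAMILY OF MAPS (lean-2 GEN-19, ours)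

Venture-side (OURS).  Cell `lqcd-flow` (pub-lqcd), unit `pub-lqcd-lean-2-g19`, 2026-08-25.  Chapter G: the swap
TOPOLOGY made a parameter.  Setting of `Scaling/ReplicaExchangeBareSampler` (levels `Fin (K+1)`, positive laws `μ_k`,
replica updates `M_k`, product target `π̃ = ⊗μ_k`).  The adjacent ladder of chapters R/F (`ptBareSampler`,
`ptFlowSampler`) is the path graph; learned maps that bridge DISTANT couplings, or a hot replica exchanging directly
with every cold one, are other graphs.  Objects (defs): `edgeFlowSwap φ i l x` — level `i` receives `φ⁻¹(x_l)`, level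
`l` receives `φ(x_i)` (an involution for `i ≠ l`); `ptGraphProposal e φ` — one of `m` edges `e_r = (i_r, l_r)` chosen
uniformly, the configurations exchanged through `φ_r`; `ptGraphSwap μ e φ = mhKernel (ptGraphProposal e φ) (tensorFun μ)`;
`ptGraphSampler t μ M e φ = t·ptGraphSwap + (1−t)·prodKernel (K+1)⁻¹ M`.

## What is proved

* §1 `edgeFlowSwap_fst` / `_snd` / `_of_ne`, **`edgeFlowSwap_edgeFlowSwap`** (involution, `i ≠ l`),
  `ptGraphProposal_symm` (edges with distinct endpoints), `_nonneg`, `sum_ptGraphProposal_le_one`,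
  `ptGraphProposal_edge_ge` (`≥ 1/m` on each image).
* §2 `ptGraphSwap`, `ptGraphSampler`: ROW-STOCHASTIC and in **DETAILED BALANCE** with `⊗μ_k` for EVERY edge list with
  distinct endpoints and EVERY maps (`0 ≤ t ≤ 1`); off-diagonal flow formula `π̃(x)·GSw(x,y) = T(x,y)·min{π̃(x),π̃(y)}`;
  `ptGraphSampler_apply`, stationarity.

NOT CLAIMED: rates — the sequel `Scaling/ReplicaExchangeGraphSwapDiffusive` gives the profile ceiling
`Gap ≤ [t/(2m)·Σ_r (a_{i_r} − a_{l_r})²D_{i_r l_r}(A) + …]/Σ_k a_k²μ_k(A)μ_k(Aᶜ)` for sector-preserving maps and reads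
off the orders `K³` (path), `K²` (complete graph), `K` (star at the hot replica) — ceilings, i.e. "at best";
continuous spaces; anything measured.  Literature grade (cell rule): KNOWN ALGORITHM CLASS, NEW TYPING; nothing cited
as a fact; no new bib keys.
-/

noncomputable section

open Finset Function
open Literature.Probability.MarkovChains

namespace Summit.Ventures.LatticeQCDFlow.Scaling

variable {S : Type*} [Fintype S] [DecidableEq S] {K m : ℕ}

/-! ## §1 The edge swap with a map, the graph proposal -/

/-- THE EDGE SWAP WITH A MAP: level `i` receives `φ⁻¹(x_l)`, level `l` receives `φ(x_i)`. [ours] -/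
def edgeFlowSwap (φ : Equiv.Perm S) (i l : Fin (K + 1)) (x : Fin (K + 1) → S) : Fin (K + 1) → S :=
  update (update x i (φ.symm (x l))) l (φ (x i))

omit [Fintype S] [DecidableEq S] in
/-- The edge swap at the second endpoint. [ours] -/
theorem edgeFlowSwap_snd (φ : Equiv.Perm S) (i l : Fin (K + 1)) (x : Fin (K + 1) → S) :
    edgeFlowSwap φ i l x l = φ (x i) := by
  unfold edgeFlowSwap; rw [update_self]

omit [Fintype S] [DecidableEq S] in
/-- The edge swap at the first endpoint (`i ≠ l`). [ours] -/
theorem edgeFlowSwap_fst (φ : Equiv.Perm S) {i l : Fin (K + 1)} (hil : i ≠ l) (x : Fin (K + 1) → S) :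
    edgeFlowSwap φ i l x i = φ.symm (x l) := by
  unfold edgeFlowSwap; rw [update_of_ne hil, update_self]

omit [Fintype S] [DecidableEq S] in
/-- The edge swap off the edge. [ours] -/
theorem edgeFlowSwap_of_ne (φ : Equiv.Perm S) (i l : Fin (K + 1)) (x : Fin (K + 1) → S) {k : Fin (K + 1)}
    (h1 : k ≠ i) (h2 : k ≠ l) : edgeFlowSwap φ i l x k = x k := by
  unfold edgeFlowSwap; rw [update_of_ne h2, update_of_ne h1]

omit [Fintype S] [DecidableEq S] in
/-- **The edge swap is an involution** (`i ≠ l`). [ours] -/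
theorem edgeFlowSwap_edgeFlowSwap (φ : Equiv.Perm S) {i l : Fin (K + 1)} (hil : i ≠ l) (x : Fin (K + 1) → S) :
    edgeFlowSwap φ i l (edgeFlowSwap φ i l x) = x := by
  funext k
  by_cases h2 : k = l
  · subst h2; rw [edgeFlowSwap_snd, edgeFlowSwap_fst φ hil, Equiv.apply_symm_apply]
  · by_cases h1 : k = i
    · subst h1; rw [edgeFlowSwap_fst φ hil, edgeFlowSwap_snd, Equiv.symm_apply_apply]
    · rw [edgeFlowSwap_of_ne φ i l _ h1 h2, edgeFlowSwap_of_ne φ i l _ h1 h2]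

omit [Fintype S] [DecidableEq S] in
/-- `y` is the edge swap of `x` iff `x` is the edge swap of `y` (`i ≠ l`). [ours] -/
theorem eq_edgeFlowSwap_comm (φ : Equiv.Perm S) {i l : Fin (K + 1)} (hil : i ≠ l) (x y : Fin (K + 1) → S) :
    y = edgeFlowSwap φ i l x ↔ x = edgeFlowSwap φ i l y := by
  constructor
  · intro h; rw [h, edgeFlowSwap_edgeFlowSwap φ hil]
  · intro h; rw [h, edgeFlowSwap_edgeFlowSwap φ hil]

/-- The graph proposal: one of the `m` edges `e_r = (i_r, l_r)` is chosen uniformly and its configurations are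
exchanged through `φ_r`. [ours] -/
def ptGraphProposal (e : Fin m → Fin (K + 1) × Fin (K + 1)) (φ : Fin m → Equiv.Perm S) (x y : Fin (K + 1) → S) : ℝ :=
  ∑ r : Fin m, if y = edgeFlowSwap (φ r) (e r).1 (e r).2 x then (1 : ℝ) / m else 0

omit [Fintype S] in
/-- The proposal is symmetric (every edge has distinct endpoints). [ours] -/
theorem ptGraphProposal_symm {e : Fin m → Fin (K + 1) × Fin (K + 1)} (he : ∀ r, (e r).1 ≠ (e r).2)
    (φ : Fin m → Equiv.Perm S) (x y : Fin (K + 1) → S) : ptGraphProposal e φ x y = ptGraphProposal e φ y x := by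
  unfold ptGraphProposal
  exact sum_congr rfl fun r _ => by rw [if_congr (eq_edgeFlowSwap_comm (φ r) (he r) x y) rfl rfl]

omit [Fintype S] in
/-- The proposal is non-negative. [ours] -/
theorem ptGraphProposal_nonneg (e : Fin m → Fin (K + 1) × Fin (K + 1)) (φ : Fin m → Equiv.Perm S)
    (x y : Fin (K + 1) → S) : 0 ≤ ptGraphProposal e φ x y :=
  sum_nonneg fun r _ => by split_ifs <;> positivity

/-- The proposal has row mass `≤ 1`. [ours] -/
theorem sum_ptGraphProposal_le_one (e : Fin m → Fin (K + 1) × Fin (K + 1)) (φ : Fin m → Equiv.Perm S)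
    (x : Fin (K + 1) → S) : ∑ y, ptGraphProposal e φ x y ≤ 1 := by
  unfold ptGraphProposal
  rw [Finset.sum_comm]
  simp_rw [Finset.sum_ite_eq' univ, if_pos (mem_univ _)]
  rw [Finset.sum_const, Finset.card_univ, Fintype.card_fin, nsmul_eq_mul]
  rcases Nat.eq_zero_or_pos m with h | h
  · subst h; simp
  · rw [mul_one_div_cancel (by exact_mod_cast h.ne')]

omit [Fintype S] in
/-- Each edge swap is proposed with weight at least `1/m`. [ours] -/
theorem ptGraphProposal_edge_ge (e : Fin m → Fin (K + 1) × Fin (K + 1)) (φ : Fin m → Equiv.Perm S)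
    (r : Fin m) (x : Fin (K + 1) → S) :
    (1 : ℝ) / m ≤ ptGraphProposal e φ x (edgeFlowSwap (φ r) (e r).1 (e r).2 x) := by
  unfold ptGraphProposal
  calc (1 : ℝ) / m = (if edgeFlowSwap (φ r) (e r).1 (e r).2 x = edgeFlowSwap (φ r) (e r).1 (e r).2 x
        then (1 : ℝ) / m else 0) := by rw [if_pos rfl]
    _ ≤ ∑ s : Fin m, (if edgeFlowSwap (φ r) (e r).1 (e r).2 x = edgeFlowSwap (φ s) (e s).1 (e s).2 x
          then (1 : ℝ) / m else 0) :=
      Finset.single_le_sum (f := fun s : Fin m =>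
          if edgeFlowSwap (φ r) (e r).1 (e r).2 x = edgeFlowSwap (φ s) (e s).1 (e s).2 x then (1 : ℝ) / m else 0)
        (fun s _ => by split_ifs <;> positivity) (mem_univ r)

/-! ## §2 The Metropolis graph swap and the sampler -/

/-- THE METROPOLIS GRAPH-SWAP MOVE: `mhKernel` of the graph proposal for the product law. [ours] -/
def ptGraphSwap (μ : Fin (K + 1) → S → ℝ) (e : Fin m → Fin (K + 1) × Fin (K + 1)) (φ : Fin m → Equiv.Perm S) :
    Matrix (Fin (K + 1) → S) (Fin (K + 1) → S) ℝ :=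
  mhKernel (ptGraphProposal e φ) (tensorFun μ)

/-- THE REPLICA-EXCHANGE SAMPLER ON A SWAP GRAPH: with probability `t` a Metropolis graph swap, with probability `1 − t`
an update of a uniform replica. [ours] -/
def ptGraphSampler (t : ℝ) (μ : Fin (K + 1) → S → ℝ) (M : Fin (K + 1) → S → S → ℝ)
    (e : Fin m → Fin (K + 1) × Fin (K + 1)) (φ : Fin m → Equiv.Perm S) :
    Matrix (Fin (K + 1) → S) (Fin (K + 1) → S) ℝ :=
  Matrix.of fun x y =>
    t * ptGraphSwap μ e φ x y + (1 - t) * prodKernel (fun _ : Fin (K + 1) => (1 : ℝ) / (K + 1)) M x y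

section Basic

variable {μ : Fin (K + 1) → S → ℝ} {M : Fin (K + 1) → S → S → ℝ} {t : ℝ}
  {e : Fin m → Fin (K + 1) × Fin (K + 1)} {φ : Fin m → Equiv.Perm S}

/-- The graph-swap move is in detailed balance with the product law. [ours] -/
theorem ptGraphSwap_detailedBalance (hμ : ∀ k x, 0 < μ k x) : DetailedBalance (tensorFun μ) (ptGraphSwap μ e φ) :=
  mhKernel_detailedBalance (tensorFun_pos hμ) _

/-- The graph-swap move is a transition matrix. [ours] -/
theorem ptGraphSwap_isRowStochastic (hμ : ∀ k x, 0 < μ k x) : IsRowStochastic (ptGraphSwap μ e φ) :=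
  ⟨mhKernel_nonneg (ptGraphProposal_nonneg e φ) (sum_ptGraphProposal_le_one e φ) (tensorFun_pos hμ),
    mhKernel_sum_eq_one _ _⟩

/-- Off the diagonal, `π̃(x)·GSw(x,y) = T(x,y)·min{π̃(x), π̃(y)}` (edges with distinct endpoints). [ours] -/
theorem tensorFun_mul_ptGraphSwap (hμ : ∀ k x, 0 < μ k x) (he : ∀ r, (e r).1 ≠ (e r).2) {x y : Fin (K + 1) → S}
    (hyx : y ≠ x) :
    tensorFun μ x * ptGraphSwap μ e φ x y = ptGraphProposal e φ x y * min (tensorFun μ x) (tensorFun μ y) := by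
  unfold ptGraphSwap
  rw [mhKernel_of_ne hyx, mul_mhRate (tensorFun_pos hμ), ptGraphProposal_symm he φ y x,
    ← min_mul_of_nonneg _ _ (ptGraphProposal_nonneg e φ x y), mul_comm]

/-- Entries of the sampler. [ours] -/
theorem ptGraphSampler_apply (t : ℝ) (μ : Fin (K + 1) → S → ℝ) (M : Fin (K + 1) → S → S → ℝ)
    (e : Fin m → Fin (K + 1) × Fin (K + 1)) (φ : Fin m → Equiv.Perm S) (x y : Fin (K + 1) → S) :
    ptGraphSampler t μ M e φ x y
      = t * ptGraphSwap μ e φ x y + (1 - t) * prodKernel (fun _ : Fin (K + 1) => (1 : ℝ) / (K + 1)) M x y := rfl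

/-- The sampler is a transition matrix (`0 ≤ t ≤ 1`, `M_k` row-stochastic). [ours] -/
theorem ptGraphSampler_isRowStochastic (hμ : ∀ k x, 0 < μ k x) (hM : ∀ k, IsRowStochastic (M k))
    (ht0 : 0 ≤ t) (ht1 : t ≤ 1) : IsRowStochastic (ptGraphSampler t μ M e φ) := by
  have hU := prodKernel_isRowStochastic M (fun _ : Fin (K + 1) => (1 : ℝ) / (K + 1)) (fun _ => by positivity)
    (sum_uniform_weight K) hM
  refine ⟨fun x y => ?_, fun x => ?_⟩
  · rw [ptGraphSampler_apply]
    exact add_nonneg (mul_nonneg ht0 ((ptGraphSwap_isRowStochastic (e := e) (φ := φ) hμ).1 x y))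
      (mul_nonneg (by linarith) (hU.1 x y))
  · simp_rw [ptGraphSampler_apply]
    rw [Finset.sum_add_distrib, ← Finset.mul_sum, ← Finset.mul_sum,
      (ptGraphSwap_isRowStochastic (e := e) (φ := φ) hμ).2 x, hU.2 x]
    ring

omit [Fintype S] in
/-- **The sampler is in DETAILED BALANCE with the product law — for every swap graph and every maps.** [ours] -/
theorem ptGraphSampler_detailedBalance [Fintype S] (hμ : ∀ k x, 0 < μ k x)
    (hMrev : ∀ k, DetailedBalance (μ k) (M k)) :
    DetailedBalance (tensorFun μ) (ptGraphSampler t μ M e φ) := by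
  intro x y
  rw [ptGraphSampler_apply, ptGraphSampler_apply]
  have h1 := ptGraphSwap_detailedBalance (e := e) (φ := φ) hμ x y
  have h2 := prodKernel_detailedBalance hMrev (fun _ : Fin (K + 1) => (1 : ℝ) / (K + 1)) x y
  calc tensorFun μ x * (t * ptGraphSwap μ e φ x y + (1 - t) * prodKernel (fun _ => (1 : ℝ) / (K + 1)) M x y)
      = t * (tensorFun μ x * ptGraphSwap μ e φ x y)
        + (1 - t) * (tensorFun μ x * prodKernel (fun _ => (1 : ℝ) / (K + 1)) M x y) := by ring
    _ = t * (tensorFun μ y * ptGraphSwap μ e φ y x)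
        + (1 - t) * (tensorFun μ y * prodKernel (fun _ => (1 : ℝ) / (K + 1)) M y x) := by rw [h1, h2]
    _ = tensorFun μ y * (t * ptGraphSwap μ e φ y x + (1 - t) * prodKernel (fun _ => (1 : ℝ) / (K + 1)) M y x) := by
        ring

/-- The product law is stationary for the graph sampler. [ours] -/
theorem ptGraphSampler_isStationary (hμ : ∀ k x, 0 < μ k x) (hM : ∀ k, IsRowStochastic (M k))
    (hMrev : ∀ k, DetailedBalance (μ k) (M k)) (ht0 : 0 ≤ t) (ht1 : t ≤ 1) :
    IsStationary (tensorFun μ) (ptGraphSampler t μ M e φ) :=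
  (ptGraphSampler_detailedBalance hμ hMrev).isStationary (ptGraphSampler_isRowStochastic hμ hM ht0 ht1).2

end Basic

end Summit.Ventures.LatticeQCDFlow.Scaling

end
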